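import Literature.NumberTheory.Sieve.MontgomeryVaughan1975MajorArcs
import Mathlib.NumberTheory.DirichletCharacter.Orthogonality
import Mathlib.Analysis.SpecialFunctions.Pow.Asymptotics
import HarnessLib

/-!
# Primes `p ≡ 1 (mod d)` for all moduli `d ≤ N^δ` off one exceptional modulus, from
# Gallagher's prime number theorem (Montgomery–Vaughan 1975, Lemma 4.3)

Topic `Literature/NumberTheory/Sieve`. THEOREMS only (no named fact is introduced); the input is
the tree's named fact `Literature.NumberTheory.Sieve.MontgomeryVaughan1975.lemma43_gallagher`
(Montgomery–Vaughan, *The exceptional set in Goldbach's problem*, Acta Arith. 27 (1975),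
Lemma 4.3 (4.2) = Gallagher, Invent. Math. 11 (1970), Theorem 7, modified):
`∑_{q ≤ P} ∑*_χ max_{x ≤ N} max_{h ≤ N} (h + N/P)⁻¹ |∑#_{x−h<p≤x} χ(p) log p| ≪ exp(−c₃ log N/log P)`
for `exp(log^{1/2} N) ≤ P ≤ N^{c₄}`, the right-hand side multiplied by `(1 − β̃) log P ≤ c₁` and
the term of the exceptional character corrected when it occurs.

We deduce the lower bound for primes in the progressions `1 (mod d)` that the counting argument
of Adleman–Pomerance–Rumely (`Literature/NumberTheory/Sieve/ShiftedPrimeDivisors.lean`, hypothesis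
(H) there) consumes — Gallagher's Theorem 7 read at `x = h = N`, `a = 1`:

* `primesInAP_lowerBound_of_lemma43_gallagher`: there are `δ > 0` and `N₀` such that for every
  `N ≥ N₀` there is `b ≥ 2` (the exceptional conductor `r̃` if the exceptional character occurs at
  level `P = N^δ`, else `⌊P⌋ + 1`) with `#{p ≤ N : p ≡ 1 (mod d)} ≥ N/(2 φ(d) log N)` for all
  `1 ≤ d ≤ N^δ` with `b ∤ d` (stated with the constant `c = 1/2` in the shape of (H)).

## The deduction

Take `x = h = N` for every `(q, χ)` in (4.2) (`charPrimeSum χ N N = ∑_{p ≤ N} χ(p) log p`). For a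
modulus `d ≤ P`, the characters `χ` mod `d` are induced by distinct primitive characters
`χ⋆ = χ.primitiveCharacter` of conductor `f ∣ d`, `f ≤ P`, so (all terms being non-negative)
`∑_{χ mod d} (N + N/P)⁻¹ ‖∑#_{p ≤ N} χ⋆(p) log p‖` is at most the double sum of (4.2)
(`sum_conductor_primitiveCharacter_le`); when the exceptional character `χ̃` mod `r̃` occurs and
`r̃ ∤ d`, no `χ⋆` is `χ̃` and the corrected terms are the plain ones. Next
`|∑_{p ≤ N} χ(p) log p − ∑_{p ≤ N} χ⋆(p) log p| ≤ ∑_{p ∣ d} log p ≤ log d`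
(`norm_sub_charPrimeSum_le`), `∑#` for `χ⋆ = 1` is `∑_{p ≤ N} log p − N`, and orthogonality gives
`φ(d) θ(N; d, 1) = ∑_χ ∑_{p ≤ N} χ(p) log p ≥ N − ∑_χ ‖∑# χ⋆‖ − φ(d) log d`
(`totient_mul_theta_ge`). With `P = N^δ`, `δ` small, the middle term is
`≤ 2N K e^{−c₃/δ} ≤ N/8` and `φ(d) log d ≤ δ N^δ log N ≤ N/4`, whence
`θ(N; d, 1) ≥ N/(2φ(d))` and `π(N; d, 1) ≥ N/(2 φ(d) log N)`.

## References

* H. L. Montgomery, R. C. Vaughan, Acta Arith. 27 (1975) 353–370, Lemma 4.3 (4.2)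
  [MontgomeryVaughanActa1975].
* P. X. Gallagher, *A large sieve density estimate near `σ = 1`*, Invent. Math. 11 (1970)
  329–339, Theorem 7 [Gallagher1970].
* L. M. Adleman, C. Pomerance, R. S. Rumely, Ann. of Math. 117 (1983) 173–206, §4 (the use of
  Theorem 7 in the proof of Proposition 10) [AdlemanPomeranceRumely1983].
-/

noncomputable section

open Finset Real Filter

namespace Literature.NumberTheory.Sieve

namespace PrimesInAPGallagher

open MontgomeryVaughan1975

/-! ### Characters mod `d` and their primitive inducers -/

/-- **The characters mod `d` embed into the primitive characters of conductor `≤ P`** (`d ≤ P`):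
`χ ↦ (f, χ⋆)`, `f` the conductor and `χ⋆` the primitive character inducing `χ`, is injective
(`changeLevel χ⋆ = χ`), so for non-negative `G` the sum of `G(f, χ⋆)` over `χ` mod `d` is at most
the double sum of `G` over all `q ≤ P` and all primitive `ψ` mod `q`. [folklore] -/
theorem sum_conductor_primitiveCharacter_le {d : ℕ} [NeZero d] {P : ℝ} (hdP : (d : ℝ) ≤ P)
    (G : (q : ℕ) → DirichletCharacter ℂ q → ℝ) (hG : ∀ q ψ, 0 ≤ G q ψ)
    (D : (q : ℕ) → DecidablePred (fun ψ : DirichletCharacter ℂ q => ψ.IsPrimitive)) :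
    ∑ χ : DirichletCharacter ℂ d, G χ.conductor χ.primitiveCharacter ≤
      ∑ q ∈ Icc 1 ⌊P⌋₊, ∑ ψ ∈ @Finset.filter _ (fun ψ : DirichletCharacter ℂ q => ψ.IsPrimitive)
        (D q) univ, G q ψ := by
  classical
  set Φ : DirichletCharacter ℂ d → (Σ q : ℕ, DirichletCharacter ℂ q) :=
    fun χ => ⟨χ.conductor, χ.primitiveCharacter⟩ with hΦ
  have key : ∀ {n₁ n₂ : ℕ} (ψ₁ : DirichletCharacter ℂ n₁) (ψ₂ : DirichletCharacter ℂ n₂)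
      (h₁ : n₁ ∣ d) (h₂ : n₂ ∣ d),
      (⟨n₁, ψ₁⟩ : Σ q : ℕ, DirichletCharacter ℂ q) = ⟨n₂, ψ₂⟩ →
        DirichletCharacter.changeLevel h₁ ψ₁ = DirichletCharacter.changeLevel h₂ ψ₂ := by
    intro n₁ n₂ ψ₁ ψ₂ h₁ h₂ h
    cases h
    rfl
  have hinj : ∀ χ₁ ∈ (univ : Finset (DirichletCharacter ℂ d)), ∀ χ₂ ∈ (univ : Finset _),
      Φ χ₁ = Φ χ₂ → χ₁ = χ₂ := by
    intro χ₁ _ χ₂ _ h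
    have := key χ₁.primitiveCharacter χ₂.primitiveCharacter χ₁.conductor_dvd_level
      χ₂.conductor_dvd_level h
    rwa [DirichletCharacter.changeLevel_primitiveCharacter,
      DirichletCharacter.changeLevel_primitiveCharacter] at this
  have hsub : (univ : Finset (DirichletCharacter ℂ d)).image Φ ⊆
      (Icc 1 ⌊P⌋₊).sigma (fun q => @Finset.filter _
        (fun ψ : DirichletCharacter ℂ q => ψ.IsPrimitive) (D q) univ) := by
    intro x hx
    obtain ⟨χ, -, rfl⟩ := Finset.mem_image.mp hx
    refine Finset.mem_sigma.mpr ⟨Finset.mem_Icc.mpr ⟨?_, ?_⟩, ?_⟩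
    · exact Nat.one_le_iff_ne_zero.mpr χ.conductor_ne_zero
    · refine Nat.le_floor ?_
      have : χ.conductor ≤ d := Nat.le_of_dvd (NeZero.pos d) χ.conductor_dvd_level
      exact le_trans (by exact_mod_cast this) hdP
    · exact Finset.mem_filter.mpr ⟨Finset.mem_univ _, χ.primitiveCharacter_isPrimitive⟩
  calc ∑ χ : DirichletCharacter ℂ d, G χ.conductor χ.primitiveCharacter
      = ∑ x ∈ (univ : Finset (DirichletCharacter ℂ d)).image Φ, G x.1 x.2 := by
        rw [Finset.sum_image hinj]
    _ ≤ ∑ x ∈ (Icc 1 ⌊P⌋₊).sigma (fun q => @Finset.filter _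
          (fun ψ : DirichletCharacter ℂ q => ψ.IsPrimitive) (D q) univ), G x.1 x.2 :=
        Finset.sum_le_sum_of_subset_of_nonneg hsub fun x _ _ => hG _ _
    _ = _ := by rw [Finset.sum_sigma']

/-- **Passing to the primitive character costs at most `log d`**: for `χ` mod `d` and
`χ⋆ = χ.primitiveCharacter`, `|∑_{p ≤ N} χ(p) log p − ∑_{p ≤ N} χ⋆(p) log p| ≤ ∑_{p ∣ d} log p ≤ log d`
(the two sums differ only at the primes dividing `d`, where `χ(p) = 0` and `|χ⋆(p)| ≤ 1`).
[folklore] -/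
theorem norm_sub_charPrimeSum_le {d : ℕ} [NeZero d] (χ : DirichletCharacter ℂ d) (N : ℕ) :
    ‖∑ p ∈ (Ioc 0 N).filter Nat.Prime, χ (p : ZMod d) * (Real.log p : ℂ) -
        charPrimeSum χ.primitiveCharacter N N‖ ≤ Real.log d := by
  classical
  set S := (Ioc 0 N).filter Nat.Prime with hS
  have hcps : charPrimeSum χ.primitiveCharacter N N =
      ∑ p ∈ S, χ.primitiveCharacter (p : ZMod χ.conductor) * (Real.log p : ℂ) := by
    rw [charPrimeSum, Nat.sub_self]
  have h1 : ∑ p ∈ S, χ (p : ZMod d) * (Real.log p : ℂ) =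
      ∑ p ∈ S.filter (fun p => p.Coprime d),
        χ.primitiveCharacter (p : ZMod χ.conductor) * (Real.log p : ℂ) := by
    rw [← Finset.sum_filter_add_sum_filter_not S (fun p => p.Coprime d)]
    have hz : ∑ p ∈ S.filter (fun p => ¬ p.Coprime d), χ (p : ZMod d) * (Real.log p : ℂ) = 0 := by
      refine Finset.sum_eq_zero fun p hp => ?_
      have hnc : ¬ p.Coprime d := (Finset.mem_filter.mp hp).2
      rw [MulChar.map_nonunit χ (mt (ZMod.isUnit_iff_coprime p d).mp hnc), zero_mul]
    rw [hz, add_zero]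
    refine Finset.sum_congr rfl fun p hp => ?_
    have hc : p.Coprime d := (Finset.mem_filter.mp hp).2
    congr 1
    have := χ.primitiveCharacter_apply_of_isCoprime (Nat.isCoprime_iff_coprime.mpr hc)
    push_cast at this
    exact this.symm
  have h2 : charPrimeSum χ.primitiveCharacter N N =
      ∑ p ∈ S.filter (fun p => p.Coprime d),
          χ.primitiveCharacter (p : ZMod χ.conductor) * (Real.log p : ℂ) +
        ∑ p ∈ S.filter (fun p => ¬ p.Coprime d),
          χ.primitiveCharacter (p : ZMod χ.conductor) * (Real.log p : ℂ) := by
    rw [hcps, Finset.sum_filter_add_sum_filter_not]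
  rw [h1, h2, sub_add_cancel_left, norm_neg]
  calc ‖∑ p ∈ S.filter (fun p => ¬ p.Coprime d),
          χ.primitiveCharacter (p : ZMod χ.conductor) * (Real.log p : ℂ)‖
      ≤ ∑ p ∈ S.filter (fun p => ¬ p.Coprime d),
          ‖χ.primitiveCharacter (p : ZMod χ.conductor) * (Real.log p : ℂ)‖ := norm_sum_le _ _
    _ ≤ ∑ p ∈ S.filter (fun p => ¬ p.Coprime d), Real.log p := by
        refine Finset.sum_le_sum fun p hp => ?_
        obtain ⟨hpS, -⟩ := Finset.mem_filter.mp hp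
        have hpp : p.Prime := (Finset.mem_filter.mp hpS).2
        have hlog : 0 ≤ Real.log p := Real.log_nonneg (by exact_mod_cast hpp.one_lt.le)
        rw [norm_mul, Complex.norm_real, Real.norm_of_nonneg hlog]
        exact mul_le_of_le_one_left hlog (DirichletCharacter.norm_le_one _ _)
    _ ≤ ∑ p ∈ d.primeFactors, Real.log p := by
        refine Finset.sum_le_sum_of_subset_of_nonneg (fun p hp => ?_) (fun p hp _ => ?_)
        · obtain ⟨hpS, hnc⟩ := Finset.mem_filter.mp hp
          have hpp : p.Prime := (Finset.mem_filter.mp hpS).2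
          have hpd : p ∣ d := by
            by_contra h; exact hnc ((Nat.Prime.coprime_iff_not_dvd hpp).mpr h)
          exact Nat.mem_primeFactors.mpr ⟨hpp, hpd, NeZero.ne d⟩
        · exact Real.log_nonneg (by exact_mod_cast (Nat.prime_of_mem_primeFactors hp).one_lt.le)
    _ = Real.log (∏ p ∈ d.primeFactors, (p : ℝ)) := by
        rw [Real.log_prod]
        intro p hp
        exact_mod_cast (Nat.prime_of_mem_primeFactors hp).ne_zero
    _ ≤ Real.log d := by
        refine Real.log_le_log (Finset.prod_pos fun p hp => ?_) ?_
        · exact_mod_cast (Nat.prime_of_mem_primeFactors hp).pos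
        · have h1 := Nat.le_of_dvd (NeZero.pos d) (Nat.prod_primeFactors_dvd d)
          have h2 : ((∏ p ∈ d.primeFactors, p : ℕ) : ℝ) ≤ d := by exact_mod_cast h1
          rwa [Nat.cast_prod] at h2

/-- **Orthogonality**: `∑_{χ mod d} ∑_{p ≤ N} χ(p) log p = φ(d) · ∑_{p ≤ N, p ≡ 1 (d)} log p`
(Mathlib's `DirichletCharacter.sum_characters_eq`). [folklore] -/
theorem sum_char_sum_eq {d : ℕ} [NeZero d] (N : ℕ) :
    ∑ χ : DirichletCharacter ℂ d, ∑ p ∈ (Ioc 0 N).filter Nat.Prime,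
        χ (p : ZMod d) * (Real.log p : ℂ) =
      (d.totient : ℂ) * ((∑ p ∈ ((Ioc 0 N).filter Nat.Prime).filter
        (fun p : ℕ => (p : ZMod d) = 1), Real.log p : ℝ) : ℂ) := by
  classical
  rw [Finset.sum_comm]
  have : ∀ p ∈ (Ioc 0 N).filter Nat.Prime,
      ∑ χ : DirichletCharacter ℂ d, χ (p : ZMod d) * (Real.log p : ℂ) =
        if (p : ZMod d) = 1 then (d.totient : ℂ) * (Real.log p : ℂ) else 0 := by
    intro p _
    rw [← Finset.sum_mul, DirichletCharacter.sum_characters_eq]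
    split_ifs <;> simp
  rw [Finset.sum_congr rfl this, ← Finset.sum_filter]
  push_cast
  rw [Finset.mul_sum]

/-- **The progression `1 (mod d)` through the characters**: with
`θ(N; d, 1) = ∑_{p ≤ N, p ≡ 1 (d)} log p` and `∑#` the term of Lemma 4.3 at `x = h = N`
(`gallagherTerm χ⋆ N N = ∑_{p ≤ N} χ⋆(p) log p − [χ⋆ = 1] N`),
`φ(d) θ(N; d, 1) ≥ N − ∑_{χ mod d} ‖∑# χ⋆‖ − φ(d) log d`.
[cite: Gallagher1970, Theorem 7 (the deduction of primes in progressions)] -/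
theorem totient_mul_theta_ge {d : ℕ} [NeZero d] (N : ℕ) :
    (N : ℝ) - ∑ χ : DirichletCharacter ℂ d, ‖gallagherTerm χ.primitiveCharacter N N‖
        - d.totient * Real.log d ≤
      d.totient * ∑ p ∈ ((Ioc 0 N).filter Nat.Prime).filter (fun p : ℕ => (p : ZMod d) = 1),
        Real.log p := by
  classical
  set S := (Ioc 0 N).filter Nat.Prime with hS
  set θ₁ : ℝ := ∑ p ∈ S.filter (fun p : ℕ => (p : ZMod d) = 1), Real.log p with hθ₁
  set Dχ : DirichletCharacter ℂ d → ℂ := fun χ =>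
    ∑ p ∈ S, χ (p : ZMod d) * (Real.log p : ℂ) - charPrimeSum χ.primitiveCharacter N N with hDχ
  have hZ := sum_char_sum_eq (d := d) N
  -- `gallagherTerm χ⋆ N N = charPrimeSum χ⋆ N N − [χ = 1] N`
  have hgt : ∀ χ : DirichletCharacter ℂ d, gallagherTerm χ.primitiveCharacter N N =
      charPrimeSum χ.primitiveCharacter N N - if χ = 1 then (N : ℂ) else 0 := by
    intro χ
    rw [gallagherTerm, Nat.sub_self, Nat.card_Ioc, Nat.sub_zero]
    congr 1
    by_cases h : χ = 1
    · rw [if_pos h, if_pos (DirichletCharacter.eq_one_iff_conductor_eq_one.mp h)]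
    · rw [if_neg h, if_neg (fun h' => h (DirichletCharacter.eq_one_iff_conductor_eq_one.mpr h'))]
  have hone : ∑ χ : DirichletCharacter ℂ d, (if χ = 1 then (N : ℂ) else 0) = N := by
    rw [Finset.sum_ite_eq']; simp
  -- the identity `φ θ₁ = N + ∑ gallagherTerm + ∑ Dχ`
  have hsum : (((d.totient : ℝ) * θ₁ : ℝ) : ℂ) =
      (N : ℂ) + ∑ χ : DirichletCharacter ℂ d, gallagherTerm χ.primitiveCharacter N N +
        ∑ χ : DirichletCharacter ℂ d, Dχ χ := by
    have hχ : ∀ χ : DirichletCharacter ℂ d, ∑ p ∈ S, χ (p : ZMod d) * (Real.log p : ℂ) =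
        gallagherTerm χ.primitiveCharacter N N + (if χ = 1 then (N : ℂ) else 0) + Dχ χ := by
      intro χ; rw [hgt χ, hDχ]; ring
    push_cast
    rw [← hZ, Finset.sum_congr rfl (fun χ _ => hχ χ), Finset.sum_add_distrib,
      Finset.sum_add_distrib, hone]
    ring
  have hre : (d.totient : ℝ) * θ₁ =
      N + (∑ χ : DirichletCharacter ℂ d, gallagherTerm χ.primitiveCharacter N N).re +
        (∑ χ : DirichletCharacter ℂ d, Dχ χ).re := by
    have := congrArg Complex.re hsum
    simpa using this
  -- bounds
  have hcard : (Finset.univ : Finset (DirichletCharacter ℂ d)).card = d.totient := by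
    rw [Finset.card_univ, ← Nat.card_eq_fintype_card,
      DirichletCharacter.card_eq_totient_of_hasEnoughRootsOfUnity]
  have hb1 : -(∑ χ : DirichletCharacter ℂ d, ‖gallagherTerm χ.primitiveCharacter N N‖) ≤
      (∑ χ : DirichletCharacter ℂ d, gallagherTerm χ.primitiveCharacter N N).re := by
    have h1 := Complex.abs_re_le_norm (∑ χ : DirichletCharacter ℂ d, gallagherTerm χ.primitiveCharacter N N)
    have h2 := norm_sum_le (Finset.univ : Finset (DirichletCharacter ℂ d))
      (fun χ => gallagherTerm χ.primitiveCharacter N N)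
    have := neg_abs_le (∑ χ : DirichletCharacter ℂ d, gallagherTerm χ.primitiveCharacter N N).re
    linarith
  have hb2 : -((d.totient : ℝ) * Real.log d) ≤ (∑ χ : DirichletCharacter ℂ d, Dχ χ).re := by
    have h1 := Complex.abs_re_le_norm (∑ χ : DirichletCharacter ℂ d, Dχ χ)
    have h2 := norm_sum_le (Finset.univ : Finset (DirichletCharacter ℂ d)) Dχ
    have h3 : ∑ χ : DirichletCharacter ℂ d, ‖Dχ χ‖ ≤ d.totient * Real.log d := by
      have := Finset.sum_le_card_nsmul (Finset.univ : Finset (DirichletCharacter ℂ d))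
        (fun χ => ‖Dχ χ‖) (Real.log d) (fun χ _ => norm_sub_charPrimeSum_le χ N)
      rwa [hcard, nsmul_eq_mul] at this
    have := neg_abs_le (∑ χ : DirichletCharacter ℂ d, Dχ χ).re
    linarith
  linarith

/-! ### The input from Lemma 4.3 -/

/-- **Lemma 4.3 at `x = h = N`, per modulus**: from
`Literature.NumberTheory.Sieve.MontgomeryVaughan1975.lemma43_gallagher` there are `c₃, c₄, K > 0`
such that for `N ≥ 1` and `exp(log^{1/2} N) ≤ P ≤ N^{c₄}`, `P ≥ 1`, there is `b ≥ 2` (the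
exceptional conductor `r̃` if the exceptional character occurs at level `P`, else `⌊P⌋ + 1`) with
`∑_{χ mod d} ‖∑#_{p ≤ N} χ⋆(p) log p‖ ≤ (N + N/P) K exp(−c₃ log N/log P)` for every `d ≤ P` with
`b ∤ d` (`K = max(C, 0) max(c₁, 1) + 1`; when `r̃ ∤ d` no character mod `d` is induced by `χ̃`,
so the corrected terms `∑#` are the plain ones, and `(1 − β̃) log P ≤ c₁`).
[cite: MontgomeryVaughanActa1975, §4 Lemma 4.3 (4.2)] [cite: Gallagher1970, Theorem 7] -/
theorem sum_norm_gallagherTerm_le (h43 : lemma43_gallagher) :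
    ∃ c₃ : ℝ, 0 < c₃ ∧ ∃ c₄ : ℝ, 0 < c₄ ∧ ∃ K : ℝ, 0 < K ∧
      ∀ (N : ℕ) (P : ℝ), 1 ≤ N → Real.exp (Real.sqrt (Real.log N)) ≤ P → P ≤ (N : ℝ) ^ c₄ →
        1 ≤ P → ∃ b : ℕ, 2 ≤ b ∧ ∀ (d : ℕ) [NeZero d], (d : ℝ) ≤ P → ¬ b ∣ d →
          ∑ χ : DirichletCharacter ℂ d, ‖gallagherTerm χ.primitiveCharacter N N‖ ≤
            ((N : ℝ) + N / P) * K * Real.exp (-c₃ * Real.log N / Real.log P) := by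
  classical
  obtain ⟨c₁, hc₁, c₃, hc₃, c₄, hc₄, C, h⟩ := h43
  refine ⟨c₃, hc₃, c₄, hc₄, max C 0 * max c₁ 1 + 1, by positivity, ?_⟩
  intro N P hN hP1 hP2 hP3
  obtain ⟨hA, hB⟩ := h N P hP1 hP2 (fun _ _ => N) (fun _ _ => N) (fun _ _ => le_rfl)
    (fun _ _ => le_rfl)
  set E : ℝ := Real.exp (-c₃ * Real.log N / Real.log P) with hE
  have hE0 : 0 < E := Real.exp_pos _
  have hN0 : (0 : ℝ) < N := by exact_mod_cast hN
  have hNP : 0 < (N : ℝ) + N / P := by positivity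
  have hC : C ≤ max C 0 * max c₁ 1 + 1 := by
    have h1 : C ≤ max C 0 := le_max_left _ _
    have h2 : max C 0 ≤ max C 0 * max c₁ 1 :=
      le_mul_of_one_le_right (le_max_right _ _) (le_max_right _ _)
    linarith
  by_cases hex : ∃ (r : ℕ) (_ : NeZero r) (χe : DirichletCharacter ℂ r) (β : ℝ),
      IsExceptionalZero c₁ P r χe β
  · -- the exceptional character occurs: `b = r̃`
    obtain ⟨r, hr, χe, β, hexc⟩ := hex
    have hB' := hB r χe β hexc
    have hr2 : 2 ≤ r := by
      obtain ⟨_, hne, -⟩ := hexc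
      have hr0 : r ≠ 0 := NeZero.ne r
      have hr1 : r ≠ 1 := by
        rintro rfl; exact hne (DirichletCharacter.level_one χe)
      omega
    refine ⟨r, hr2, fun d _ hdP hrd => ?_⟩
    -- the corrected terms of the `χ⋆`, `χ` mod `d`, are the plain ones
    have hplain : ∀ χ : DirichletCharacter ℂ d,
        gallagherTermExc χe β χ.primitiveCharacter N N = gallagherTerm χ.primitiveCharacter N N := by
      intro χ
      rw [gallagherTermExc, if_neg, add_zero]
      rintro ⟨hcond, -⟩
      exact hrd (hcond ▸ χ.conductor_dvd_level)
    have hemb := sum_conductor_primitiveCharacter_le hdP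
      (fun q ψ => ((N : ℝ) + N / P)⁻¹ * ‖gallagherTermExc χe β ψ N N‖)
      (fun q ψ => by positivity) (fun q => inferInstance)
    have hbound : ∑ χ : DirichletCharacter ℂ d,
        ((N : ℝ) + N / P)⁻¹ * ‖gallagherTermExc χe β χ.primitiveCharacter N N‖ ≤
          C * ((1 - β) * Real.log P) * E := by
      refine hemb.trans ?_
      convert hB' using 2
    -- `C (1 − β) log P ≤ K`
    have hβ : 0 ≤ (1 - β) * Real.log P ∧ (1 - β) * Real.log P ≤ c₁ := by
      obtain ⟨-, -, -, hβ, hβ1, -⟩ := hexc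
      have hlog : 0 ≤ Real.log P := Real.log_nonneg hP3
      refine ⟨mul_nonneg (by linarith) hlog, ?_⟩
      rcases hlog.eq_or_lt with h0 | hpos
      · rw [← h0, mul_zero]; exact hc₁.le
      · have h1 : 1 - β ≤ c₁ / Real.log P := by linarith
        calc (1 - β) * Real.log P ≤ c₁ / Real.log P * Real.log P :=
              mul_le_mul_of_nonneg_right h1 hpos.le
          _ = c₁ := div_mul_cancel₀ c₁ hpos.ne'
    have hCK : C * ((1 - β) * Real.log P) ≤ max C 0 * max c₁ 1 + 1 := by
      have h1 : C * ((1 - β) * Real.log P) ≤ max C 0 * ((1 - β) * Real.log P) :=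
        mul_le_mul_of_nonneg_right (le_max_left _ _) hβ.1
      have h2 : max C 0 * ((1 - β) * Real.log P) ≤ max C 0 * max c₁ 1 :=
        mul_le_mul_of_nonneg_left (hβ.2.trans (le_max_left _ _)) (le_max_right _ _)
      linarith
    have hsum : ∑ χ : DirichletCharacter ℂ d, ‖gallagherTerm χ.primitiveCharacter N N‖ =
        ((N : ℝ) + N / P) * ∑ χ : DirichletCharacter ℂ d,
          ((N : ℝ) + N / P)⁻¹ * ‖gallagherTermExc χe β χ.primitiveCharacter N N‖ := by
      rw [Finset.mul_sum]
      refine Finset.sum_congr rfl fun χ _ => ?_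
      rw [hplain χ, ← mul_assoc, mul_inv_cancel₀ hNP.ne', one_mul]
    rw [hsum, mul_assoc]
    refine mul_le_mul_of_nonneg_left ?_ hNP.le
    calc _ ≤ C * ((1 - β) * Real.log P) * E := hbound
      _ ≤ (max C 0 * max c₁ 1 + 1) * E := mul_le_mul_of_nonneg_right hCK hE0.le
  · -- no exceptional character: `b = ⌊P⌋ + 1` divides no `d ≤ P`
    push Not at hex
    have hA' := hA (fun r _ χ β hx => hex r inferInstance χ β hx)
    refine ⟨⌊P⌋₊ + 1, by have := Nat.le_floor (by exact_mod_cast hP3 : ((1 : ℕ) : ℝ) ≤ P); omega,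
      fun d _ hdP _ => ?_⟩
    have hemb := sum_conductor_primitiveCharacter_le hdP
      (fun q ψ => ((N : ℝ) + N / P)⁻¹ * ‖gallagherTerm ψ N N‖)
      (fun q ψ => by positivity) (fun q => inferInstance)
    have hbound : ∑ χ : DirichletCharacter ℂ d,
        ((N : ℝ) + N / P)⁻¹ * ‖gallagherTerm χ.primitiveCharacter N N‖ ≤ C * E := by
      refine hemb.trans ?_
      convert hA' using 2
    have hsum : ∑ χ : DirichletCharacter ℂ d, ‖gallagherTerm χ.primitiveCharacter N N‖ =
        ((N : ℝ) + N / P) * ∑ χ : DirichletCharacter ℂ d,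
          ((N : ℝ) + N / P)⁻¹ * ‖gallagherTerm χ.primitiveCharacter N N‖ := by
      rw [Finset.mul_sum]
      refine Finset.sum_congr rfl fun χ _ => ?_
      rw [← mul_assoc, mul_inv_cancel₀ hNP.ne', one_mul]
    rw [hsum, mul_assoc]
    refine mul_le_mul_of_nonneg_left ?_ hNP.le
    calc _ ≤ C * E := hbound
      _ ≤ (max C 0 * max c₁ 1 + 1) * E := mul_le_mul_of_nonneg_right hC hE0.le

/-! ### The lower bound for primes `p ≡ 1 (mod d)` -/

/-- **Primes `p ≡ 1 (mod d)` in the Linnik–Gallagher range, from Lemma 4.3** (Gallagher 1970,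
Theorem 7, at `x = h = N`, `a = 1`; the hypothesis (H) of
`Literature/NumberTheory/Sieve/ShiftedPrimeDivisors.lean` with `c = 1/2`): assuming
`Literature.NumberTheory.Sieve.MontgomeryVaughan1975.lemma43_gallagher`, there are `δ > 0` and `N₀`
such that for every `N ≥ N₀` there is `b ≥ 2` with
`#{p ≤ N prime : p ≡ 1 (mod d)} ≥ (1/2) N/(φ(d) log N)` for all `1 ≤ d ≤ N^δ` with `b ∤ d`
(`b` = the exceptional conductor at level `N^δ` if the exceptional character occurs, else
`⌊N^δ⌋ + 1`; `δ = min(c₄, 1/2, c₃/(16K))`).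
[cite: Gallagher1970, Theorem 7] [cite: MontgomeryVaughanActa1975, §4 Lemma 4.3 (4.2)] -/
theorem primesInAP_lowerBound_of_lemma43_gallagher (h43 : lemma43_gallagher) :
    ∃ c : ℝ, 0 < c ∧ ∃ δ : ℝ, 0 < δ ∧ ∃ N₀ : ℕ, ∀ N : ℕ, N₀ ≤ N → ∃ b : ℕ, 2 ≤ b ∧
      ∀ d : ℕ, 1 ≤ d → (d : ℝ) ≤ (N : ℝ) ^ δ → ¬ b ∣ d →
        c * N / (Nat.totient d * Real.log N) ≤
          (((Finset.Iic N).filter (fun p => p.Prime ∧ p ≡ 1 [MOD d])).card : ℝ) := by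
  classical
  obtain ⟨c₃, hc₃, c₄, hc₄, K, hK, hE⟩ := sum_norm_gallagherTerm_le h43
  set δ : ℝ := min (min c₄ (1 / 2)) (c₃ / (16 * K)) with hδ
  have hδ0 : 0 < δ := lt_min (lt_min hc₄ (by norm_num)) (by positivity)
  have hδc₄ : δ ≤ c₄ := (min_le_left _ _).trans (min_le_left _ _)
  have hδh : δ ≤ 1 / 2 := (min_le_left _ _).trans (min_le_right _ _)
  have hδK : δ ≤ c₃ / (16 * K) := min_le_right _ _
  refine ⟨1 / 2, by norm_num, δ, hδ0, ?_⟩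
  -- eventual conditions on `N`
  have hlogN : Tendsto (fun N : ℕ => Real.log N) atTop atTop :=
    Real.tendsto_log_atTop.comp tendsto_natCast_atTop_atTop
  have hev : ∀ᶠ N : ℕ in atTop, 2 ≤ N ∧ 1 / δ ^ 2 ≤ Real.log N ∧
      Real.log N ≤ 1 / (4 * δ) * (N : ℝ) ^ (1 - δ) := by
    refine (eventually_ge_atTop 2).and ((hlogN.eventually (eventually_ge_atTop _)).and ?_)
    have h1 : ∀ᶠ x : ℝ in atTop, ‖Real.log x‖ ≤ 1 / (4 * δ) * ‖x ^ (1 - δ)‖ :=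
      (isLittleO_log_rpow_atTop (by linarith : 0 < 1 - δ)).def (by positivity)
    have h2 := tendsto_natCast_atTop_atTop.eventually (h1.and (eventually_ge_atTop (1 : ℝ)))
    filter_upwards [h2] with N hN
    obtain ⟨hN, hN1⟩ := hN
    rwa [Real.norm_of_nonneg (Real.log_nonneg hN1),
      Real.norm_of_nonneg (Real.rpow_nonneg (by linarith) _)] at hN
  obtain ⟨N₀, hN₀⟩ := eventually_atTop.mp hev
  refine ⟨N₀, fun N hN => ?_⟩
  obtain ⟨hN2, hlog1, hlog2⟩ := hN₀ N hN
  have hN0 : (0 : ℝ) < N := by exact_mod_cast (show 0 < N by omega)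
  have hN1 : (1 : ℝ) < N := by exact_mod_cast (show 1 < N by omega)
  have hL0 : 0 < Real.log N := Real.log_pos hN1
  set P : ℝ := (N : ℝ) ^ δ with hP
  have hP1 : 1 ≤ P := Real.one_le_rpow hN1.le hδ0.le
  have hPc₄ : P ≤ (N : ℝ) ^ c₄ := Real.rpow_le_rpow_of_exponent_le hN1.le hδc₄
  have hlogP : Real.log P = δ * Real.log N := Real.log_rpow hN0 δ
  have hPexp : Real.exp (Real.sqrt (Real.log N)) ≤ P := by
    rw [hP, Real.rpow_def_of_pos hN0]
    refine Real.exp_le_exp.mpr ?_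
    have hsq : Real.sqrt (Real.log N) * Real.sqrt (Real.log N) = Real.log N :=
      Real.mul_self_sqrt hL0.le
    have h1 : 1 ≤ δ * Real.sqrt (Real.log N) := by
      have h0 : 0 ≤ δ * Real.sqrt (Real.log N) := by positivity
      have h2 : 1 ≤ (δ * Real.sqrt (Real.log N)) ^ 2 := by
        rw [mul_pow, Real.sq_sqrt hL0.le]
        have := hlog1
        rw [div_le_iff₀ (by positivity)] at this
        linarith
      nlinarith
    calc Real.sqrt (Real.log N) = Real.sqrt (Real.log N) * 1 := (mul_one _).symm
      _ ≤ Real.sqrt (Real.log N) * (δ * Real.sqrt (Real.log N)) :=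
          mul_le_mul_of_nonneg_left h1 (Real.sqrt_nonneg _)
      _ = Real.log N * δ := by
          rw [show Real.sqrt (Real.log N) * (δ * Real.sqrt (Real.log N)) =
            δ * (Real.sqrt (Real.log N) * Real.sqrt (Real.log N)) by ring, hsq, mul_comm]
  obtain ⟨b, hb2, hbd⟩ := hE N P (by omega) hPexp hPc₄ hP1
  refine ⟨b, hb2, fun d hd1 hdP hbd' => ?_⟩
  haveI : NeZero d := ⟨by omega⟩
  -- the error term: `≤ (N + N/P) K e^{−c₃/δ} ≤ 2N K δ/c₃ ≤ N/8`
  have hexp : Real.exp (-c₃ * Real.log N / Real.log P) ≤ δ / c₃ := by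
    rw [hlogP]
    have : -c₃ * Real.log N / (δ * Real.log N) = -(c₃ / δ) := by field_simp
    rw [this, Real.exp_neg]
    have ht : 0 < c₃ / δ := by positivity
    have h1 := Real.add_one_le_exp (c₃ / δ)
    rw [inv_le_comm₀ (Real.exp_pos _) (by positivity), inv_div]
    linarith
  have hEd : ∑ χ : DirichletCharacter ℂ d, ‖gallagherTerm χ.primitiveCharacter N N‖ ≤
      (N : ℝ) / 8 := by
    refine (hbd d hdP hbd').trans ?_
    have h1 : (N : ℝ) + N / P ≤ 2 * N := by
      have : (N : ℝ) / P ≤ N := div_le_self hN0.le hP1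
      linarith
    calc ((N : ℝ) + N / P) * K * Real.exp (-c₃ * Real.log N / Real.log P)
        ≤ (2 * N) * K * (δ / c₃) := by gcongr
      _ ≤ (2 * N) * K * (c₃ / (16 * K) / c₃) := by gcongr
      _ = N / 8 := by field_simp; ring
  -- `φ(d) log d ≤ d log d ≤ N^δ · δ log N ≤ N/4`
  have hdlog : (d.totient : ℝ) * Real.log d ≤ (N : ℝ) / 4 := by
    have hφ : (d.totient : ℝ) ≤ d := by exact_mod_cast Nat.totient_le d
    have hd0 : (0 : ℝ) < d := by exact_mod_cast hd1
    have hlogd : Real.log d ≤ δ * Real.log N := by rw [← hlogP]; exact Real.log_le_log hd0 hdP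
    have hlogd0 : 0 ≤ Real.log d := Real.log_nonneg (by exact_mod_cast hd1)
    calc (d.totient : ℝ) * Real.log d ≤ d * Real.log d := mul_le_mul_of_nonneg_right hφ hlogd0
      _ ≤ P * (δ * Real.log N) := mul_le_mul hdP hlogd hlogd0 (by positivity)
      _ ≤ P * (δ * (1 / (4 * δ) * (N : ℝ) ^ (1 - δ))) := by gcongr
      _ = (N : ℝ) ^ δ * (N : ℝ) ^ (1 - δ) / 4 := by rw [hP]; field_simp
      _ = N / 4 := by rw [← Real.rpow_add hN0]; norm_num
  -- `θ(N; d, 1) ≥ N/(2 φ(d))`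
  have hθ := totient_mul_theta_ge (d := d) N
  set θ₁ : ℝ := ∑ p ∈ ((Ioc 0 N).filter Nat.Prime).filter (fun p : ℕ => (p : ZMod d) = 1),
    Real.log p with hθ₁
  have hφ0 : (0 : ℝ) < d.totient := by exact_mod_cast Nat.totient_pos.mpr (by omega)
  have hθlow : (N : ℝ) / 2 ≤ d.totient * θ₁ := by linarith
  -- `θ₁ ≤ #{p ≤ N : p ≡ 1 (d)} · log N`
  have hset : ((Ioc 0 N).filter Nat.Prime).filter (fun p : ℕ => (p : ZMod d) = 1) =
      (Finset.Iic N).filter (fun p => p.Prime ∧ p ≡ 1 [MOD d]) := by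
    ext p
    simp only [Finset.mem_filter, Finset.mem_Ioc, Finset.mem_Iic]
    constructor
    · rintro ⟨⟨⟨-, hpN⟩, hpp⟩, hp1⟩
      refine ⟨hpN, hpp, ?_⟩
      have := (ZMod.natCast_eq_natCast_iff p 1 d).mp (by rw [hp1, Nat.cast_one])
      exact this
    · rintro ⟨hpN, hpp, hp1⟩
      refine ⟨⟨⟨hpp.pos, hpN⟩, hpp⟩, ?_⟩
      have := (ZMod.natCast_eq_natCast_iff p 1 d).mpr hp1
      rwa [Nat.cast_one] at this
  have hθup : θ₁ ≤ (((Finset.Iic N).filter (fun p => p.Prime ∧ p ≡ 1 [MOD d])).card : ℝ) *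
      Real.log N := by
    rw [hθ₁, hset]
    have := Finset.sum_le_card_nsmul ((Finset.Iic N).filter (fun p => p.Prime ∧ p ≡ 1 [MOD d]))
      (fun p => Real.log p) (Real.log N) (fun p hp => ?_)
    · rwa [nsmul_eq_mul] at this
    · obtain ⟨hpN, hpp, -⟩ := by simpa [Finset.mem_filter] using hp
      exact Real.log_le_log (by exact_mod_cast hpp.pos) (by exact_mod_cast hpN)
  -- conclude
  rw [div_le_iff₀ (by positivity)]
  have := mul_le_mul_of_nonneg_left hθup hφ0.le
  nlinarith

end PrimesInAPGallagher

end Literature.NumberTheory.Sieve
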